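import Literature.NumberTheory.EllipticCurves.BSDSelmer
import Literature.NumberTheory.EllipticCurves.KrizLi2019.TwoPartBSDTwists
import Mathlib.NumberTheory.NumberField.InfinitePlace.TotallyRealComplex
import HarnessLib

/-!
# Mazur–Rubin 2010, *Ranks of twists of elliptic curves and Hilbert's tenth problem*,
# Prop. 3.3 / Cor. 3.4 (ii): the `2`-Selmer rank is UNCHANGED under a quadratic twist whose local
# conditions agree everywhere — AS PRINTED, special case `K = ℚ`

HONEST FRAMING (cell `bsd-uniform`, track U2, run/shared/lean/pub/bsd-uniform/; typed by seat u2-p1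
for route A «direct transport through the printed 2-adic control theorem», offered to u2-lit / the
referee for the line-by-line check): a PUBLISHED theorem vendored as a named `Prop` (nothing
asserted, nothing discharged; D-0014), every printed hypothesis a binder, with locators into the held
text. It is the CONTROL statement at `p = 2` that route A consumes by name; it closes nothing by
itself and no per-curve certificate is counted as a uniform theorem.

Source. B. Mazur, K. Rubin, *Ranks of twists of elliptic curves and Hilbert's tenth problem*,
Invent. Math. 181 (2010), 541–575 [MazurRubin2010]. Text read: the held DASH copy
`paper:anon2010-ranks-twists-elliptic-curves-hilberts-tenth-problem` (27 pp.; locators `pNNNN.txt:Lk`).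

## The printed statements (verbatim)

* §2 standing (p0006 L27, p0007 L46–L49): "Fix for this section a number field `K`. … Fix for the
  rest of this section an elliptic curve `E/K` and a quadratic extension `F/K`. Recall that `E^F` is
  the twist of `E` by `F/K`. Let `Δ_E` be the discriminant of some model of `E`."
  Definition 2.3 (p0007 L5–L14): "The 2-Selmer group `Sel₂(E/K) ⊂ H¹(K, E[2])` is the (finite)
  `𝔽₂`-vector space defined by the exactness of the sequence
  `0 → Sel₂(E/K) → H¹(K, E[2]) → ⊕_v H¹(K_v, E[2])/H¹_f(K_v, E[2])`. … Recall that
  `d₂(E/K) := dim_{𝔽₂} Sel₂(E/K)`."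
* **Proposition 3.3** (p0009 L63–L75): "Suppose that all of the following places split in `F/K`:
  • all primes where `E` has additive reduction, • all `v` of multiplicative reduction such that
  `ord_v(Δ_E)` is even, • all primes above `2`, • all real places `v` with `(Δ_E)_v > 0`, and suppose
  in addition that all `v` of multiplicative reduction such that `ord_v(Δ_E)` is odd are unramified
  in `F/K`. Let `T` be the set of (finite) primes `p` of `K` such that `F/K` is ramified at `p` and
  `E(K_p)[2] ≠ 0`. Then `d₂(E^F/K) = d₂(E/K) − dim_{𝔽₂} V_T + d` for some `d` satisfying
  `0 ≤ d ≤ dim_{𝔽₂}(⊕_{p∈T} H¹_f(K_p, E[2])/V_T)`, `d ≡ dim_{𝔽₂}(⊕_{p∈T} H¹_f(K_p, E[2])/V_T) (mod 2)`."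
* **Corollary 3.4** (p0010 L51–L58): "Suppose `E`, `F/K`, and `T` are as in Proposition 3.3.
  (i) If `dim_{𝔽₂}(⊕_{p∈T} H¹_f(K_p, E[2])/V_T) ≤ 1`, then
  `d₂(E^F/K) = d₂(E/K) − 2 dim_{𝔽₂} V_T + Σ_{p∈T} dim_{𝔽₂} H¹_f(K_p, E[2])`.
  (ii) If `E(K_p)[2] = 0` for every `p ∈ T`, then `d₂(E^F/K) = d₂(E/K)`.
  Proof. … For (ii), note that `T` is empty in this case, so (ii) follows from (i)."
* The local criteria behind it, Lemma 2.10 (p0008 L26–L34): "If at least one of the following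
  conditions (i)-(v) holds: (i) `v` splits in `F/K`, or (ii) `v ∤ 2∞` and `E(K_v)[2] = 0`, or
  (iii) `E` has multiplicative reduction at `v`, `F/K` is unramified at `v`, and `ord_v(Δ_E)` is odd,
  or (iv) `v` is real and `(Δ_E)_v < 0`, or (v) `v` is a prime where `E` has good reduction and `v`
  is unramified in `F/K`, then `H¹_f(K_v, E[2]) = H¹_f(K_v, E^F[2])` and `δ_v(E, F/K) = 0`"
  (Cor. 3.4 (ii) = `cor34ii_rat` is the numbered consumable statement; the place-wise form —
  Lemma 2.10 at every place + Def. 2.3, the first display of the proof of Prop. 3.3 with `T = ∅`,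
  p0009 L81–L83 "By Lemma 2.10, `H¹_f(K_v,E[2]) = H¹_f(K_v,E^F[2])` if `v ∉ T`. Therefore
  `S_T ⊂ Sel₂(E^F/K) ⊂ S^T`", where `S_∅ = S^∅ = Sel₂(E/K)` by Def. 3.1 — is `d2_eq_of_lemma210_rat`
  below).

## Transcription (tree dictionary), special case `K = ℚ`

* `E/ℚ` = any Weierstrass model `W : WeierstrassCurve ℚ` with `[W.IsElliptic]` (`d₂`, the reduction
  types and the parity of `ord_v(Δ_E)` — "the discriminant of some model" — are model-independent);
  `ord_p(Δ_E)` = `padicValRat p W.Δ`.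
* `F/ℚ` quadratic = a number field `F` with `Module.finrank ℚ F = 2` containing a square root of a
  square-free integer `d ≠ 1` (so `F = ℚ(√d)`); the twist `E^F` = `E^{(d)}` = any model `W'` with
  `C • W' = W.quadraticTwist d` (idiom of `QuadraticTwist.lean`, `KrizLi2019`, `CaiLiZhai2019`).
* "a prime `p` splits in `F`" = `((Ideal.span {(p : ℤ)}).primesOver (𝓞 F)).ncard = 2` (idiom of
  `KrizLi2019.InS`); "`F/ℚ` is ramified at `p`" = `(p : ℤ) ∣ NumberField.discr F` (Dedekind's
  discriminant theorem; for the quadratic field `ℚ(√d)` these are the primes of `d`, and `2` when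
  `d ≢ 1 (mod 4)`); "unramified" = its negation; "all real places split in `F`" (there is one real
  place of `ℚ`) = `NumberField.IsTotallyReal F` (Mathlib).
* Reduction types at a prime `p`: the tree's `W.HasGoodReductionAtPrime p`,
  `W.HasMultiplicativeReductionAtPrime p` (`Tamagawa.lean`); "additive" = neither (as in `KrizLi2019`).
* "`E(K_p)[2] = 0`" = every `Q ∈ E(ℚ_p)` with `2 • Q = 0` is `0`, on `(W.baseChange ℚ_[p]).toAffine.Point`.
* "`d₂(E^F/K) = d₂(E/K)`" = `Nat.card (W'.selmerGroup 2) = Nat.card (W.selmerGroup 2)` (the tree's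
  `WeierstrassCurve.selmerGroup n ⊆ H¹(K, E[n])`, `Selmer.lean`, is MR's `Sel₂` for `n = 2`:
  classes unobstructed in `H¹(K_v, E)` at every place, i.e. lying in the Kummer image
  `H¹_f(K_v, E[2])`; both are finite elementary abelian `2`-groups, so equal dimension = equal order).
* The hypothesis of (ii), "`E(K_p)[2] = 0` for every `p ∈ T`" with `T` = {ramified `p` with
  `E(K_p)[2] ≠ 0`}, is transcribed as its content "`T = ∅`": every prime ramified in `F/ℚ` has
  `E(ℚ_p)[2] = 0`.
-- TODO(general form): the statement over an arbitrary number field `K` (real places `v` with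
-- `(Δ_E)_v > 0`, primes of `K` above `2`), Prop. 3.3's inequality for `T ≠ ∅` and Cor. 3.4 (i).

Nothing is asserted: users take `(h : cor34ii_rat)`, `(h : d2_eq_of_lemma210_rat)` or `(h : prop33_rat)`
(Prop. 3.3 for `T ≠ ∅`, `V_T`-free consequences; appended 2026-08-27 for the cell `bsd-f1-sign2`).
-/

noncomputable section

open scoped Classical

open NumberField WeierstrassCurve Literature.NumberTheory.EllipticCurves

namespace Literature.NumberTheory.EllipticCurves.MazurRubin2010

/-- **Mazur–Rubin 2010, Cor. 3.4 (ii) with the hypotheses of Prop. 3.3, special case `K = ℚ`**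
(Invent. Math. 181 (2010); verbatim in the module docstring). For an elliptic `E/ℚ` (model `W`), a
square-free integer `d ≠ 1` and the quadratic field `F = ℚ(√d)`: IF every prime of additive
reduction splits in `F`, every prime of multiplicative reduction with `ord_p(Δ_E)` even splits in
`F`, `2` splits in `F`, the real place splits in `F` whenever `Δ_E > 0` (i.e. `F` is real), every
prime of multiplicative reduction with `ord_p(Δ_E)` odd is unramified in `F`, AND (`T = ∅`)
`E(ℚ_p)[2] = 0` for every prime `p` ramified in `F` — THEN `d₂(E^F/ℚ) = d₂(E/ℚ)`:
`#Sel₂(E^{(d)}/ℚ) = #Sel₂(E/ℚ)` for every model `W'` of the twist. Named fact (PUBLISHED); nothing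
asserted. [cite: MazurRubin2010, Cor. 3.4 (ii) with Prop. 3.3 (DASH copy p0009 L63–L75, p0010 L51–L58)] -/
def cor34ii_rat : Prop :=
  ∀ (W : WeierstrassCurve ℚ) [W.IsElliptic] (d : ℤ), Squarefree d → d ≠ 1 →
    ∀ (F : Type) [Field F] [NumberField F], Module.finrank ℚ F = 2 → (∃ x : F, x ^ 2 = (d : F)) →
    -- the hypotheses of Prop. 3.3 (K = ℚ):
    (∀ (p : ℕ) [Fact p.Prime], ¬ W.HasGoodReductionAtPrime p → ¬ W.HasMultiplicativeReductionAtPrime p →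
        ((Ideal.span {(p : ℤ)}).primesOver (𝓞 F)).ncard = 2) →
    (∀ (p : ℕ) [Fact p.Prime], W.HasMultiplicativeReductionAtPrime p → Even (padicValRat p W.Δ) →
        ((Ideal.span {(p : ℤ)}).primesOver (𝓞 F)).ncard = 2) →
    ((Ideal.span {(2 : ℤ)}).primesOver (𝓞 F)).ncard = 2 →
    (0 < W.Δ → NumberField.IsTotallyReal F) →
    (∀ (p : ℕ) [Fact p.Prime], W.HasMultiplicativeReductionAtPrime p → Odd (padicValRat p W.Δ) →
        ¬ (p : ℤ) ∣ NumberField.discr F) →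
    -- Cor. 3.4 (ii): `T = ∅`
    (∀ (p : ℕ) [Fact p.Prime], (p : ℤ) ∣ NumberField.discr F →
        ∀ Q : (W.baseChange ℚ_[p]).toAffine.Point, 2 • Q = 0 → Q = 0) →
    ∀ (W' : WeierstrassCurve ℚ) [W'.IsElliptic],
      (∃ C : VariableChange ℚ, C • W' = W.quadraticTwist (d : ℚ)) →
        Nat.card (W'.selmerGroup 2) = Nat.card (W.selmerGroup 2)

/-- **Mazur–Rubin 2010, Lemma 2.10 (i)–(v) at every place, with Def. 2.3 — the place-wise form of
the control (special case `K = ℚ`).** Printed pieces: Lemma 2.10 (p0008 L26–L34) "If at least one of the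
following conditions (i)-(v) holds: (i) `v` splits in `F/K`, or (ii) `v ∤ 2∞` and `E(K_v)[2] = 0`, or
(iii) `E` has multiplicative reduction at `v`, `F/K` is unramified at `v`, and `ord_v(Δ_E)` is odd, or
(iv) `v` is real and `(Δ_E)_v < 0`, or (v) `v` is a prime where `E` has good reduction and `v` is
unramified in `F/K`, then `H¹_f(K_v, E[2]) = H¹_f(K_v, E^F[2])`"; Def. 2.3 (p0007 L5–L9): `Sel₂(E/K)`
and `Sel₂(E^F/K)` are the subgroups of `H¹(K, E[2])` (= `H¹(K, E^F[2])`, Remark 2.4) cut out by these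
local conditions; and the mechanism as printed in the proof of Prop. 3.3, first display (p0009
L81–L83): "By Lemma 2.10, `H¹_f(K_v,E[2]) = H¹_f(K_v,E^F[2])` if `v ∉ T`. Therefore
`S_T ⊂ Sel₂(E^F/K) ⊂ S^T`" — with `T = ∅` (Def. 3.1: `S_∅ = S^∅ = Sel₂(E/K)`) this reads
`Sel₂(E^F/K) = Sel₂(E/K)`. STATEMENT (K = ℚ, F = ℚ(√d)): if at EVERY prime `p` one of (i), (ii),
(iii), (v) holds and at the real place (i) (`F` real) or (iv) (`Δ_E < 0`) holds, then
`d₂(E^F/ℚ) = d₂(E/ℚ)`. This is a lemma-plus-definition assembly that MR prove but do not number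
(the cell's lit seat's reading, HOME/u2/INGREDIENTS.md §9: TYPABLE with this locator pair; the numbered
Cor. 3.4 (ii) = `cor34ii_rat` is the special case where Prop. 3.3's splitting list guarantees a
disjunct at each place); every disjunct keeps its printed side condition ((ii): `v ∤ 2∞`; (iii):
multiplicative AND unramified AND `ord_v Δ` odd; (v): GOOD reduction AND unramified). Named fact
(PUBLISHED mechanism); nothing asserted. Dictionary as for `cor34ii_rat`.
[cite: MazurRubin2010, Lemma 2.10 (i)–(v) (DASH copy p0008 L26–L34) with Def. 2.3 (p0007 L5–L9); proof of Prop. 3.3, first display (p0009 L81–L83), T = ∅] -/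
def d2_eq_of_lemma210_rat : Prop :=
  ∀ (W : WeierstrassCurve ℚ) [W.IsElliptic] (d : ℤ), Squarefree d → d ≠ 1 →
    ∀ (F : Type) [Field F] [NumberField F], Module.finrank ℚ F = 2 → (∃ x : F, x ^ 2 = (d : F)) →
    -- Lemma 2.10 at every (finite) prime `p`: (i) ∨ (ii) ∨ (iii) ∨ (v)
    (∀ (p : ℕ) [Fact p.Prime],
      ((Ideal.span {(p : ℤ)}).primesOver (𝓞 F)).ncard = 2 ∨
      (p ≠ 2 ∧ ∀ Q : (W.baseChange ℚ_[p]).toAffine.Point, 2 • Q = 0 → Q = 0) ∨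
      (W.HasMultiplicativeReductionAtPrime p ∧ ¬ (p : ℤ) ∣ NumberField.discr F ∧
        Odd (padicValRat p W.Δ)) ∨
      (W.HasGoodReductionAtPrime p ∧ ¬ (p : ℤ) ∣ NumberField.discr F)) →
    -- Lemma 2.10 at the real place of `ℚ`: (i) it splits (`F` real) ∨ (iv) `Δ_E < 0`
    (NumberField.IsTotallyReal F ∨ W.Δ < 0) →
    ∀ (W' : WeierstrassCurve ℚ) [W'.IsElliptic],
      (∃ C : VariableChange ℚ, C • W' = W.quadraticTwist (d : ℚ)) →
        Nat.card (W'.selmerGroup 2) = Nat.card (W.selmerGroup 2)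

/-- **Mazur–Rubin 2010, Prop. 3.3 for `T ≠ ∅` (the `V_T`-free consequences), special case `K = ℚ` and
every `T`-prime with `E(ℚ_p)[2] ≅ ℤ/2`.** Printed statement (p0009 L63–L75, verbatim in the module
docstring): under the splitting list (additive primes, multiplicative primes with `ord_p Δ_E` even, the
prime `2`, the real place if `Δ_E > 0` all SPLIT in `F`; multiplicative primes with `ord_p Δ_E` odd
UNRAMIFIED), with `T` = the set of finite primes `p` ramified in `F/ℚ` with `E(ℚ_p)[2] ≠ 0`,
"`d₂(E^F/K) = d₂(E/K) − dim_{𝔽₂} V_T + d` for some `d` satisfying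
`0 ≤ d ≤ dim_{𝔽₂}(⊕_{p∈T} H¹_f(K_p, E[2])/V_T)`, `d ≡ dim_{𝔽₂}(⊕_{p∈T} H¹_f(K_p, E[2])/V_T) (mod 2)`."
Here `V_T := loc_T(Sel₂(E/K)) ⊂ ⊕_{p∈T} H¹_f(K_p, E[2])` (Def. 3.1, p0009 L32), so with
`t := Σ_{p∈T} dim H¹_f(ℚ_p, E[2])` and `s := dim V_T ∈ [0, t]`: `d₂(E^F) − d₂(E) = d − s ∈ [−t, t]` and
`d₂(E^F) − d₂(E) ≡ (t − s) − s ≡ t (mod 2)`; and `dim H¹_f(ℚ_p, E[2]) = dim E(ℚ_p)[2]` for `p ∤ 2∞`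
(Lemma 2.2 (i), p0006 L33–L34; every `T`-prime is odd because `2` splits in `F`). In the special case
typed here — each `T`-prime has `E(ℚ_p)[2]` of order EXACTLY `2` — `t = #T`, and the two `V_T`-free
consequences read: `|d₂(E^F/ℚ) − d₂(E/ℚ)| ≤ #T` and `d₂(E^F/ℚ) ≡ d₂(E/ℚ) + #T (mod 2)`, i.e. (both
Selmer groups being finite elementary abelian `2`-groups) `#Sel₂(E^F) ∣ 2^{#T}·#Sel₂(E)`,
`#Sel₂(E) ∣ 2^{#T}·#Sel₂(E^F)`, and `#T` is even iff `#Sel₂(E^F)·#Sel₂(E)` is a square. `T` is pinned by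
two clauses: every `p ∈ T` is a prime ramified in `F` with `#E(ℚ_p)[2] = 2`, and every prime ramified in
`F` outside `T` has `E(ℚ_p)[2] = 0`. Dictionary as for `cor34ii_rat`. Named fact (PUBLISHED, a
consequence of the printed proposition by the two lines of arithmetic above); nothing asserted. This is
the module's TODO «Prop. 3.3's inequality for `T ≠ ∅`» in the currency the cell `bsd-f1-sign2` (seat
-es, `SelmerTrivialTwistLocusAtTwo`) consumes; the PLACE-WISE generalisation (Lemma 2.10 disjuncts at
the primes outside `T` instead of the splitting list) is NOT vendored as a fact — it is a theorem to be
proved from Lemmas 2.9–2.11 and duality (cell REF1-AUDIT §14).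
[cite: MazurRubin2010, Prop. 3.3 (DASH copy p0009 L63–L75) with Def. 3.1 (p0009 L32) and Lemma 2.2 (i) (p0006 L33–L34)] -/
def prop33_rat : Prop :=
  ∀ (W : WeierstrassCurve ℚ) [W.IsElliptic] (d : ℤ), Squarefree d → d ≠ 1 →
    ∀ (F : Type) [Field F] [NumberField F], Module.finrank ℚ F = 2 → (∃ x : F, x ^ 2 = (d : F)) →
    -- the splitting list of Prop. 3.3 (K = ℚ), verbatim as in `cor34ii_rat`:
    (∀ (p : ℕ) [Fact p.Prime], ¬ W.HasGoodReductionAtPrime p → ¬ W.HasMultiplicativeReductionAtPrime p →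
        ((Ideal.span {(p : ℤ)}).primesOver (𝓞 F)).ncard = 2) →
    (∀ (p : ℕ) [Fact p.Prime], W.HasMultiplicativeReductionAtPrime p → Even (padicValRat p W.Δ) →
        ((Ideal.span {(p : ℤ)}).primesOver (𝓞 F)).ncard = 2) →
    ((Ideal.span {(2 : ℤ)}).primesOver (𝓞 F)).ncard = 2 →
    (0 < W.Δ → NumberField.IsTotallyReal F) →
    (∀ (p : ℕ) [Fact p.Prime], W.HasMultiplicativeReductionAtPrime p → Odd (padicValRat p W.Δ) →
        ¬ (p : ℤ) ∣ NumberField.discr F) →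
    -- `T` = the primes ramified in `F` with `E(ℚ_p)[2] ≠ 0`, here each with `#E(ℚ_p)[2] = 2`:
    ∀ (T : Finset ℕ),
      (∀ p ∈ T, p.Prime ∧ (p : ℤ) ∣ NumberField.discr F ∧
        ∀ [Fact p.Prime], Nat.card {Q : (W.baseChange ℚ_[p]).toAffine.Point // 2 • Q = 0} = 2) →
      (∀ (p : ℕ) [Fact p.Prime], (p : ℤ) ∣ NumberField.discr F → p ∉ T →
        ∀ Q : (W.baseChange ℚ_[p]).toAffine.Point, 2 • Q = 0 → Q = 0) →
    ∀ (W' : WeierstrassCurve ℚ) [W'.IsElliptic],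
      (∃ C : VariableChange ℚ, C • W' = W.quadraticTwist (d : ℚ)) →
        Nat.card (W'.selmerGroup 2) ∣ 2 ^ T.card * Nat.card (W.selmerGroup 2) ∧
        Nat.card (W.selmerGroup 2) ∣ 2 ^ T.card * Nat.card (W'.selmerGroup 2) ∧
        (Even T.card ↔ IsSquare (Nat.card (W'.selmerGroup 2) * Nat.card (W.selmerGroup 2)))
-- TODO(general form): `T`-primes with `E(ℚ_p)[2] = E[2]` (then `t = Σ dim E(ℚ_p)[2]`), general `K`,
-- and the full statement with `V_T` and Cor. 3.4 (i).

/-- **Cor. 3.4 (ii) from Prop. 3.3, as in the paper** ("note that `T` is empty in this case"):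
`prop33_rat` with `T = ∅` gives the conclusion of `cor34ii_rat` (`2^0 · n = n`; mutual divisibility of
the two orders gives equality) — a kernel check of the transcription.
[cite: MazurRubin2010, Cor. 3.4 (ii) (DASH copy p0010 L51–L58)] -/
theorem prop33_rat.card_eq_of_empty (h : prop33_rat) (W : WeierstrassCurve ℚ) [W.IsElliptic] (d : ℤ)
    (hd : Squarefree d) (hd1 : d ≠ 1) (F : Type) [Field F] [NumberField F]
    (hF : Module.finrank ℚ F = 2) (hx : ∃ x : F, x ^ 2 = (d : F))
    (h1 : ∀ (p : ℕ) [Fact p.Prime], ¬ W.HasGoodReductionAtPrime p →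
      ¬ W.HasMultiplicativeReductionAtPrime p → ((Ideal.span {(p : ℤ)}).primesOver (𝓞 F)).ncard = 2)
    (h2 : ∀ (p : ℕ) [Fact p.Prime], W.HasMultiplicativeReductionAtPrime p → Even (padicValRat p W.Δ) →
      ((Ideal.span {(p : ℤ)}).primesOver (𝓞 F)).ncard = 2)
    (h3 : ((Ideal.span {(2 : ℤ)}).primesOver (𝓞 F)).ncard = 2)
    (h4 : 0 < W.Δ → NumberField.IsTotallyReal F)
    (h5 : ∀ (p : ℕ) [Fact p.Prime], W.HasMultiplicativeReductionAtPrime p → Odd (padicValRat p W.Δ) →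
      ¬ (p : ℤ) ∣ NumberField.discr F)
    (hT : ∀ (p : ℕ) [Fact p.Prime], (p : ℤ) ∣ NumberField.discr F →
      ∀ Q : (W.baseChange ℚ_[p]).toAffine.Point, 2 • Q = 0 → Q = 0)
    (W' : WeierstrassCurve ℚ) [W'.IsElliptic] (hW' : ∃ C : VariableChange ℚ, C • W' = W.quadraticTwist (d : ℚ)) :
    Nat.card (W'.selmerGroup 2) = Nat.card (W.selmerGroup 2) := by
  obtain ⟨hdvd, hdvd', -⟩ := h W d hd hd1 F hF hx h1 h2 h3 h4 h5 ∅ (fun p hp ↦ absurd hp (by simp))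
    (fun p _ hp _ Q hQ ↦ hT p hp Q hQ) W' hW'
  rw [Finset.card_empty, pow_zero, one_mul] at hdvd hdvd'
  exact Nat.dvd_antisymm hdvd hdvd'

/-! ## Cor. 3.4 (i) WITH `V_T`, at a SINGLE ramified prime `q` with `#E(ℚ_q)[2] = 2` (appended 2026-08-28 by the
cell `bsd-f1-sign2` typer for the consumers T-q₀ `F1Sign2.TranspositionDoor.TranspositionTwistLawAtTwo` (-an) and T-C
`EggTwistLawAtTwo` (-desc): the `V_T` clause that the `V_T`-free `prop33_rat` leaves as a TODO)

PRINT (DASH copy `paper:arxiv-0904.3709`, de-TeXed pages): Def. 3.1 [p0008 L6–30]: "`loc_T : H¹(K,E[2]) → ⊕_{v∈T} H¹(K_v,E[2])`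
denote the sum of the localization maps … `𝒮_T ⊂ 𝒮^T ⊂ H¹(K,E[2])` … `0 → 𝒮_T → 𝒮^T →(loc_T) ⊕_{v∈T} H¹(K_v,E[2])` …
Then by definition `𝒮_T ⊂ Sel₂(E/K) ⊂ 𝒮^T`, and we define `V_T := loc_T(Sel₂(E/K)) ⊂ ⊕_{v∈T} H¹_f(K_v,E[2])`."
Lemma 2.2 (i) [p0006 L16–18]: "If `v ∤ 2∞` then `dim_{𝔽₂} H¹_f(K_v,E[2]) = dim_{𝔽₂} E(K_v)[2]`."
Cor. 3.4 (i) [p0008 L150–161]: "Suppose `E`, `F/K`, and `T` are as in Proposition 3.3. (i) If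
`dim_{𝔽₂}(⊕_{𝔭∈T} H¹_f(K_𝔭,E[2])/V_T) ≤ 1`, then `d₂(E^F/K) = d₂(E/K) − 2 dim_{𝔽₂} V_T + Σ_{𝔭∈T} dim_{𝔽₂} H¹_f(K_𝔭,E[2])`."
(`d₂(E/K) := dim_{𝔽₂} Sel₂(E/K)` [p0003 L40].)

TRANSCRIPTION (special case `K = ℚ`, `T = {q}` a single prime with `#E(ℚ_q)[2] = 2`; weaker than print, never stronger): by
Lemma 2.2 (i) (`q` is odd since `2` splits in `F`) `dim H¹_f(ℚ_q,E[2]) = 1`, so `V_T ⊂ H¹_f(ℚ_q,E[2]) ≅ 𝔽₂` has dimension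
`s ∈ {0,1}` and the hypothesis of Cor. 3.4 (i) (`1 − s ≤ 1`) holds; the conclusion reads `d₂(E^F) = d₂(E) + 1 − 2s`.
`s = 0` iff `loc_q(Sel₂(E/ℚ)) = 0` iff `Sel₂(E/ℚ) ⊆ ker(loc_q : H¹(ℚ,E[2]) → H¹(ℚ_q,E[2]))` — the STRICT local condition at
`q`, carried here by the definition `strictLocalKer W ℚ_[q] 2` (the kernel of the restriction to `Γ_{ℚ_q}` with `E[2]`-coefficients,
built by the tree's `resKer` exactly like `selmerLocalKer` but with the torsion target `E(ℚ̄_q)[2]` instead of `E(ℚ̄_q)`). In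
`Nat.card` currency (both Selmer groups finite elementary abelian `2`-groups of orders `2^{d₂}`): `s = 0 ⇒ #Sel₂(E^F) = 2·#Sel₂(E)`;
`s = 1 ⇒ #Sel₂(E) = 2·#Sel₂(E^F)`. Dictionary otherwise as for `cor34ii_rat` / `prop33_rat`. -/

section StrictLocalCondition

universe u

variable {K : Type u} [Field K] (W : WeierstrassCurve K) (E : Type u) [Field E] [Algebra K E]

/-- The points map `E[n](K̄) → E(K̄_E)[n]` (the tree's `pointsMap W E : E(K̄) → E(K̄_E)` restricted to the `n`-torsion and
co-restricted to the `n`-torsion of the target — a group homomorphism preserves `n • P = 0`). A definition (carrier for the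
strict local condition below). Silverman, *AEC*, X.§4; Serre, *Galois Cohomology*, II.§1. [folklore] -/
def pointsMapTorsion (n : ℤ) : W.geomTorsion n →+ AddSubgroup.torsionBy (localPoints W E) n :=
  ((pointsMap W E).comp (W.geomTorsion n).subtype).codRestrict (AddSubgroup.torsionBy (localPoints W E) n) fun P ↦ by
    have hP : n • (P : W.geomPoints) = 0 := (Submodule.mem_torsionBy_iff n (P : W.geomPoints)).mp P.2
    refine (Submodule.mem_torsionBy_iff n _).mpr ?_
    simp only [AddMonoidHom.coe_comp, AddSubgroup.coe_subtype, Function.comp_apply]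
    rw [← map_zsmul, hP, map_zero]

/-- Unfolding of `pointsMapTorsion` on underlying points: it IS `pointsMap` (definitional; private plumbing). [folklore] -/
@[simp]
private theorem coe_pointsMapTorsion (n : ℤ) (P : W.geomTorsion n) :
    ((pointsMapTorsion W E n P : AddSubgroup.torsionBy (localPoints W E) n) : localPoints W E) = pointsMap W E (P : W.geomPoints) :=
  rfl

/-- The **STRICT local condition at the `K`-field `E`** (a completion `K_v`): the kernel of the restriction
`H¹(K, E[n]) → H¹(E, E(K̄_E)[n])` with TORSION coefficients (Mazur–Rubin's `ker loc_v` of Def. 3.1), built by the tree's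
`resKer` along the compatible pair `(resGal E, pointsMapTorsion)` — compare `WeierstrassCurve.selmerLocalKer W E n`, the
RELAXED (classical) condition, whose target is `H¹(E, E(K̄_E))`. The `Γ_E`-action on `E(K̄_E)[n]` is the tree's generic
instance `AddSubgroup.torsionBy.instDistribMulAction`; no new instance is declared.
[cite: MazurRubin2010, Def. 3.1 (DASH copy p0008 L6–30)] -/
def strictLocalKer (n : ℤ) : AddSubgroup (W.galH1Torsion n) :=
  resKer (resGal (K := K) E) (pointsMapTorsion W E n) fun σ P ↦ by
    apply Subtype.ext
    simp only [coe_pointsMapTorsion, Literature.NumberTheory.EllipticCurves.AddSubgroup.torsionBy.coe_smul]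
    exact pointsMap_smul W E σ P

end StrictLocalCondition

/-- **Mazur–Rubin 2010, Cor. 3.4 (i) with the hypotheses of Prop. 3.3, special case `K = ℚ`, `T = {q}` ONE prime with
`#E(ℚ_q)[2] = 2`, WITH the `V_T` clause** (see the section docstring for the printed text and the two-line transcription):
under the splitting list of Prop. 3.3 (verbatim as in `cor34ii_rat` / `prop33_rat`), with `q` a prime ramified in `F` such that
`#E(ℚ_q)[2] = 2` and every OTHER prime ramified in `F` having `E(ℚ_p)[2] = 0` (so `T = {q}`), for every model `W'` of the twist
`E^F = E^{(d)}`: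
if `Sel₂(E/ℚ)` is STRICT at `q` (`V_T = 0`) then `#Sel₂(E^F/ℚ) = 2 · #Sel₂(E/ℚ)` (`d₂` goes UP by one), and
if `Sel₂(E/ℚ)` is NOT strict at `q` (`V_T = H¹_f(ℚ_q,E[2]) ≅ 𝔽₂`) then `#Sel₂(E/ℚ) = 2 · #Sel₂(E^F/ℚ)` (`d₂` goes DOWN by one).
Named fact (PUBLISHED: Cor. 3.4 (i) + Lemma 2.2 (i) + Def. 3.1, with the arithmetic `d₂(E^F) = d₂(E) + 1 − 2s`, `s ∈ {0,1}`);
nothing asserted, no `_holds`. Consumers (cell `bsd-f1-sign2`): `F1Sign2.TranspositionDoor.TranspositionTwistLawAtTwo` (T-q₀,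
`T = {q₀}` a transposition prime at `Δ < 0`) and `EggTwistLawAtTwo` (T-C; there `T = ∅` and the real place plays the role of `q` —
NOT covered by this finite-prime instance), each modulo the Kummer-theoretic reading of «strict at `q`» (for `Ш(E)[2] = 0` and
`E(ℚ)[2] = 0`: `Sel₂(E) = δ(E(ℚ))`, and `loc_q δ(P) = 0 ⟺ P ∈ 2E(ℚ_q) ⟺ P̃ ∈ 2Ẽ(𝔽_q)` at an odd good `q` — Kramer 1981 Prop. 3's
coset; that reading is glue for the consumers, not part of this printed fact).
[cite: MazurRubin2010, Cor. 3.4 (i) (DASH copy p0008 L150–L161) with Prop. 3.3 (p0008 L50–L82), Def. 3.1 (p0008 L6–L30), Lemma 2.2 (i) (p0006 L16–L18)] -/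
def cor34i_singleton_rat : Prop :=
  ∀ (W : WeierstrassCurve ℚ) [W.IsElliptic] (d : ℤ), Squarefree d → d ≠ 1 →
    ∀ (F : Type) [Field F] [NumberField F], Module.finrank ℚ F = 2 → (∃ x : F, x ^ 2 = (d : F)) →
    -- the splitting list of Prop. 3.3 (K = ℚ), verbatim as in `cor34ii_rat`:
    (∀ (p : ℕ) [Fact p.Prime], ¬ W.HasGoodReductionAtPrime p → ¬ W.HasMultiplicativeReductionAtPrime p →
        ((Ideal.span {(p : ℤ)}).primesOver (𝓞 F)).ncard = 2) →
    (∀ (p : ℕ) [Fact p.Prime], W.HasMultiplicativeReductionAtPrime p → Even (padicValRat p W.Δ) →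
        ((Ideal.span {(p : ℤ)}).primesOver (𝓞 F)).ncard = 2) →
    ((Ideal.span {(2 : ℤ)}).primesOver (𝓞 F)).ncard = 2 →
    (0 < W.Δ → NumberField.IsTotallyReal F) →
    (∀ (p : ℕ) [Fact p.Prime], W.HasMultiplicativeReductionAtPrime p → Odd (padicValRat p W.Δ) →
        ¬ (p : ℤ) ∣ NumberField.discr F) →
    -- `T = {q}`: `q` ramified in `F` with `#E(ℚ_q)[2] = 2`, every other ramified prime with `E(ℚ_p)[2] = 0`:
    ∀ (q : ℕ) [Fact q.Prime], (q : ℤ) ∣ NumberField.discr F →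
      Nat.card {Q : (W.baseChange ℚ_[q]).toAffine.Point // 2 • Q = 0} = 2 →
      (∀ (p : ℕ) [Fact p.Prime], (p : ℤ) ∣ NumberField.discr F → p ≠ q →
        ∀ Q : (W.baseChange ℚ_[p]).toAffine.Point, 2 • Q = 0 → Q = 0) →
    ∀ (W' : WeierstrassCurve ℚ) [W'.IsElliptic],
      (∃ C : VariableChange ℚ, C • W' = W.quadraticTwist (d : ℚ)) →
        (W.selmerGroup 2 ≤ strictLocalKer W ℚ_[q] 2 →
          Nat.card (W'.selmerGroup 2) = 2 * Nat.card (W.selmerGroup 2)) ∧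
        (¬ W.selmerGroup 2 ≤ strictLocalKer W ℚ_[q] 2 →
          Nat.card (W.selmerGroup 2) = 2 * Nat.card (W'.selmerGroup 2))
-- TODO(general form): arbitrary finite `T` with `V_T` as a subspace of `⊕_{p∈T} H¹_f(ℚ_p, E[2])` (Prop. 3.3's `d` and
-- Cor. 3.4 (i) verbatim), `T`-primes with `E(ℚ_p)[2] = E[2]`, general `K`; and the real-place analogue (T-C's `T = ∅` case,
-- where MR's hypothesis «real places with `(Δ_E)_v > 0` split» is dropped — NOT Prop. 3.3 as printed).

/-- Kernel check of the transcription's arithmetic: with `#Sel₂(E) = 2` (rank one, `Ш(E)[2] = 0`, `E(ℚ)[2] = 0`) the two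
branches give `#Sel₂(E^F) = 4` (strict) and `#Sel₂(E^F) = 1` (not strict) — the values in T-q₀ (an instance of the cited
corollary, proved from the named fact by arithmetic). [cite: MazurRubin2010, Cor. 3.4 (i) (DASH copy p0008 L150–L161)] -/
theorem cor34i_singleton_rat.card_twist_of_card_eq_two (h : cor34i_singleton_rat)
    (W : WeierstrassCurve ℚ) [W.IsElliptic] (d : ℤ) (hd : Squarefree d) (hd1 : d ≠ 1)
    (F : Type) [Field F] [NumberField F] (hF : Module.finrank ℚ F = 2) (hx : ∃ x : F, x ^ 2 = (d : F))
    (h1 : ∀ (p : ℕ) [Fact p.Prime], ¬ W.HasGoodReductionAtPrime p →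
      ¬ W.HasMultiplicativeReductionAtPrime p → ((Ideal.span {(p : ℤ)}).primesOver (𝓞 F)).ncard = 2)
    (h2 : ∀ (p : ℕ) [Fact p.Prime], W.HasMultiplicativeReductionAtPrime p → Even (padicValRat p W.Δ) →
      ((Ideal.span {(p : ℤ)}).primesOver (𝓞 F)).ncard = 2)
    (h3 : ((Ideal.span {(2 : ℤ)}).primesOver (𝓞 F)).ncard = 2)
    (h4 : 0 < W.Δ → NumberField.IsTotallyReal F)
    (h5 : ∀ (p : ℕ) [Fact p.Prime], W.HasMultiplicativeReductionAtPrime p → Odd (padicValRat p W.Δ) →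
      ¬ (p : ℤ) ∣ NumberField.discr F)
    (q : ℕ) [Fact q.Prime] (hq : (q : ℤ) ∣ NumberField.discr F)
    (hq2 : Nat.card {Q : (W.baseChange ℚ_[q]).toAffine.Point // 2 • Q = 0} = 2)
    (hT : ∀ (p : ℕ) [Fact p.Prime], (p : ℤ) ∣ NumberField.discr F → p ≠ q →
      ∀ Q : (W.baseChange ℚ_[p]).toAffine.Point, 2 • Q = 0 → Q = 0)
    (W' : WeierstrassCurve ℚ) [W'.IsElliptic] (hW' : ∃ C : VariableChange ℚ, C • W' = W.quadraticTwist (d : ℚ))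
    (hcard : Nat.card (W.selmerGroup 2) = 2) :
    (W.selmerGroup 2 ≤ strictLocalKer W ℚ_[q] 2 → Nat.card (W'.selmerGroup 2) = 4) ∧
      (¬ W.selmerGroup 2 ≤ strictLocalKer W ℚ_[q] 2 → Nat.card (W'.selmerGroup 2) = 1) := by
  obtain ⟨hup, hdown⟩ := h W d hd hd1 F hF hx h1 h2 h3 h4 h5 q hq hq2 hT W' hW'
  refine ⟨fun hs ↦ ?_, fun hs ↦ ?_⟩
  · rw [hup hs, hcard]
  · have := hdown hs
    rw [hcard] at this
    omega

end Literature.NumberTheory.EllipticCurves.MazurRubin2010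

end
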